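import Mathlib
import Summits.AnomalousDissipation.AnomalousDissipation.Theses.LimitingAbsorption
import Literature.Analysis.FluidPDE.PassiveScalarForced
import Literature.Analysis.FluidPDE.PassiveScalar
import Literature.Analysis.FluidPDE.ZerothLaw
import HarnessLib

/-!
# Crux `LimitingAbsorption.FloorUpgrade` (stmt-AnomalousDissipation-15010) — strategist census sketch

Companion to `STRATEGY-CENSUS.md` (wall-breaker strategist gen 1, 2026-08-17): the TYPED forms of the
attempts recorded there, so that "as a signature" is literal. Nothing here is a line or a proposal;
every `def … : Prop` is either a hypothesis class, a candidate sub-crux that the census REJECTS (with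
the reason in its docstring), or a Disproof-side target. The three `theorem`s are the kernel-checked
wirings the census relies on:

* `relaxingFamily_iff` — `RelaxingFamily` as data + clauses (bookkeeping for case splits);
* `floorUpgrade_of_enstrophyCases` — the enstrophy-anomaly case split (census §Decomposition D4) IS a
  typed split with a one-line glue; it is rejected for lack of teeth, not for lack of typing;
* `universalTransfer_iff_not_relaxingFamily` — given the vorticity lock (`NoUniversalRelaxer`, chain
  BN5 / r2-N1, here the hypothesis `hLock`), the profile-universality transfer
  `RelaxingFamily → UniversalRelaxingFamily` is EQUIVALENT to refuting crux r3 (census §Transfer T3(a),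
  §Decomposition D2: the `stub_boost` death foreseen);
* `budgetedKinematicFloor_false_of` — the budget-augmented kinematic floor (census §Strengthen S4) is
  refuted by a BUDGET-RESPECTING coboundary relaxer exactly as `K1_kin` is by the chain's one
  (`Ideator4.kinematicSameFamilyFloor_false_of`); the toy `brcr.py` probes whether such a relaxer exists.
-/

noncomputable section

open MeasureTheory Set Filter Topology
open scoped ENNReal NNReal InnerProductSpace
open Literature.Analysis Literature.Analysis.FluidPDE Literature.Analysis.FluidPDE.Torus
open Literature.Analysis.FunctionSpaces.Torus
open Summit.AnomalousDissipation.AnomalousDissipation.Theses.LimitingAbsorption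

namespace Summit.AnomalousDissipation.AnomalousDissipation.Cruxes.FloorUpgrade.Strategist1

set_option linter.dupNamespace false -- D-0017: `Summit.<S>.<S>.…` namespace by design

local notation "𝕋²" => UnitAddTorus (Fin 2)
local notation "E²" => EuclideanSpace ℝ (Fin 2)

/-! ## 0. Clauses as predicates -/

/-- The relaxation clause `(U_f)` of `RelaxingFamily` for a drift family `v`, diffusivities `ν`,
constants `(C, γ)` and a profile `f`: every weak solution released from `f` at any phase `s ≥ 0` decays
like `C e^{-γ t}` in `L²`, uniformly in `j` and `s`. -/
def UniformlyRelaxes (ν : ℕ → ℝ) (v : ℕ → ℝ → 𝕋² → E²) (C γ : ℝ) (f : 𝕋² → ℝ) : Prop :=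
  ∀ (j : ℕ) (s : ℝ), 0 ≤ s → ∀ (T : ℝ) (θ : ℝ → 𝕋² → ℝ),
    IsWeakScalarTransportOn T (ν j) (fun t => v j (s + t)) f θ →
      ∀ᵐ t ∂(volume.restrict (Ioo (0 : ℝ) T)),
        scalarL2Sq (θ t) ≤ C * Real.exp (-(γ * t)) * scalarL2Sq f

/-- The absorbed-power floor `(ABS)` for the family `(ν, v)` and the steady source `h`, uniform in `j`. -/
def HasFloor (ν : ℕ → ℝ) (v : ℕ → ℝ → 𝕋² → E²) (h : 𝕋² → ℝ) : Prop :=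
  ∃ ε : ℝ, 0 < ε ∧ ∀ j : ℕ, ∃ θ : ℝ → 𝕋² → ℝ,
    IsWeakScalarTransportForced (ν j) (v j) (fun _ => h) 0 θ ∧
    ε ≤ longTimeAvgSup (fun t => ν j * (eScalarGradNormSq (θ t)).toReal)

/-- `RelaxingFamily`'s body as a predicate on its data `(g, h, ν, v₀, v)` and constants `(E, C, γ)`. -/
def RelaxingData (g : 𝕋² → E²) (h : 𝕋² → ℝ) (ν : ℕ → ℝ) (v₀ : ℕ → 𝕋² → E²)
    (v : ℕ → ℝ → 𝕋² → E²) (E C γ : ℝ) : Prop :=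
  IsSmooth g ∧ IsDivFree g ∧ HasZeroMean g ∧ IsSmooth h ∧ HasZeroMean h ∧ h ≠ 0 ∧
  (∀ j, 0 < ν j) ∧ Tendsto ν atTop (𝓝 0) ∧
  (∀ j, IsGlobalLerayHopf (ν j) (fun _ => g) (v₀ j) (v j)) ∧
  (∀ j : ℕ, ∀ (T : ℝ), 0 < T → MemLp (stLift (v j)) ⊤ (volume.restrict (Ioo (0 : ℝ) T ×ˢ univ))) ∧
  (∀ j, meanEnergy (v j) ≤ E) ∧ 0 ≤ C ∧ 0 < γ ∧ UniformlyRelaxes ν v C γ h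

/-- Bookkeeping: crux r3 is "some data satisfy `RelaxingData`". [folklore] -/
theorem relaxingFamily_iff :
    RelaxingFamily ↔ ∃ g h ν v₀ v E C γ, RelaxingData g h ν v₀ v E C γ := by
  constructor
  · rintro ⟨g, h, hg, hgd, hgm, hh, hhm, hh0, ν, v₀, v, hν, hνl, hLH, hbd, ⟨E, hE⟩, C, γ, hC, hγ, hU⟩
    exact ⟨g, h, ν, v₀, v, E, C, γ, hg, hgd, hgm, hh, hhm, hh0, hν, hνl, hLH, hbd, hE, hC, hγ, hU⟩
  · rintro ⟨g, h, ν, v₀, v, E, C, γ, hg, hgd, hgm, hh, hhm, hh0, hν, hνl, hLH, hbd, hE, hC, hγ, hU⟩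
    exact ⟨g, h, hg, hgd, hgm, hh, hhm, hh0, ν, v₀, v, hν, hνl, hLH, hbd, ⟨E, hE⟩, C, γ, hC, hγ, hU⟩

/-- The same-family floor turns relaxing data into thesis X (no subsequence needed in this uniform
form; the sharper `∃ᶠ j` form K1′ is p121456's `floorUpgrade_of_not_relaxingFamilyUnder_noFloor`). [folklore] -/
theorem uniformRelaxationWitness_of_floor {g : 𝕋² → E²} {h : 𝕋² → ℝ} {ν : ℕ → ℝ}
    {v₀ : ℕ → 𝕋² → E²} {v : ℕ → ℝ → 𝕋² → E²} {E C γ : ℝ}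
    (hD : RelaxingData g h ν v₀ v E C γ) (hF : HasFloor ν v h) : UniformRelaxationWitness := by
  obtain ⟨hg, hgd, hgm, hh, hhm, -, hν, hνl, hLH, hbd, hE, hC, hγ, hU⟩ := hD
  obtain ⟨ε, hε, hfl⟩ := hF
  exact ⟨g, h, hg, hgd, hgm, hh, hhm, ν, v₀, v, hν, hνl, hLH, hbd, ⟨E, hE⟩, ⟨C, γ, hC, hγ, hU⟩, ε, hε, hfl⟩

/-- K1 (uniform form of the same-family floor): the only content proper to the crux (census §0). -/
def SameFamilyFloor : Prop :=
  ∀ (g : 𝕋² → E²) (h : 𝕋² → ℝ) (ν : ℕ → ℝ) (v₀ : ℕ → 𝕋² → E²) (v : ℕ → ℝ → 𝕋² → E²) (E C γ : ℝ),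
    RelaxingData g h ν v₀ v E C γ → HasFloor ν v h

/-- `SameFamilyFloor → FloorUpgrade` (the honest reduction; kernel-checked). [folklore] -/
theorem floorUpgrade_of_sameFamilyFloor (hK : SameFamilyFloor) : FloorUpgrade := by
  intro hR
  obtain ⟨g, h, ν, v₀, v, E, C, γ, hD⟩ := relaxingFamily_iff.1 hR
  exact uniformRelaxationWitness_of_floor hD (hK g h ν v₀ v E C γ hD)

/-! ## 1. Decomposition D4 (enstrophy-anomaly case split) — typed, glued, REJECTED for lack of teeth -/

/-- Enstrophy-injection anomaly of a steadily forced family, typed velocity-only (no vorticity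
regularity needed): `η_j = ⟨⟨curl g, ω_j⟩⟩ = ⟨⟨-Δg, v_j⟩⟩` stays `≥ η₀ > 0` for infinitely many `j`.
For 2-D Leray–Hopf families this is the mean enstrophy DISSIPATION rate (enstrophy balance). -/
def EnstrophyAnomaly (g : 𝕋² → E²) (v : ℕ → ℝ → 𝕋² → E²) : Prop :=
  ∃ η₀ : ℝ, 0 < η₀ ∧ ∃ᶠ j in atTop,
    η₀ ≤ longTimeAvgSup (fun t => ∫ x, ⟪-(laplacian g x), v j t x⟫_ℝ)

/-- Sub₁ of D4: relaxing families WITHOUT enstrophy anomaly yield X. Keeps every enemy (flat foliated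
coboundary structures force `η_∞ = 0` by the mean momentum balance; census §Negation N3), so it is the
whole crux restricted — REJECTED. -/
def FloorUpgradeNoAnomaly : Prop :=
  ∀ (g : 𝕋² → E²) (h : 𝕋² → ℝ) (ν : ℕ → ℝ) (v₀ : ℕ → 𝕋² → E²) (v : ℕ → ℝ → 𝕋² → E²) (E C γ : ℝ),
    RelaxingData g h ν v₀ v E C γ → ¬ EnstrophyAnomaly g v → UniformRelaxationWitness

/-- Sub₂ of D4: relaxing families WITH an enstrophy anomaly yield X. Excludes flat enemies only; curved
foliations carry `curl div(RS) ≠ 0` — REJECTED (no strict weakening a prover can use). -/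
def FloorUpgradeAnomaly : Prop :=
  ∀ (g : 𝕋² → E²) (h : 𝕋² → ℝ) (ν : ℕ → ℝ) (v₀ : ℕ → 𝕋² → E²) (v : ℕ → ℝ → 𝕋² → E²) (E C γ : ℝ),
    RelaxingData g h ν v₀ v E C γ → EnstrophyAnomaly g v → UniformRelaxationWitness

/-- The glue of D4 (kernel-checked): the split is genuine as TYPING; its pieces are not genuinely
smaller than K1′, which is why it is not filed. [folklore] -/
theorem floorUpgrade_of_enstrophyCases (h₁ : FloorUpgradeNoAnomaly) (h₂ : FloorUpgradeAnomaly) :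
    FloorUpgrade := by
  intro hR
  obtain ⟨g, h, ν, v₀, v, E, C, γ, hD⟩ := relaxingFamily_iff.1 hR
  by_cases hA : EnstrophyAnomaly g v
  · exact h₂ g h ν v₀ v E C γ hD hA
  · exact h₁ g h ν v₀ v E C γ hD hA

/-! ## 2. Transfer T3(a) / Decomposition D2: profile-universality is EQUIVALENT to refuting r3 -/

/-- A UNIVERSAL relaxing family: relaxing data whose flow relaxes EVERY smooth mean-zero profile with
the same constants (the transplant of HCR25b / Armstrong–Vicol / BBPS-type universal mixing). -/
def UniversalRelaxingFamily : Prop :=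
  ∃ (g : 𝕋² → E²) (h : 𝕋² → ℝ) (ν : ℕ → ℝ) (v₀ : ℕ → 𝕋² → E²) (v : ℕ → ℝ → 𝕋² → E²) (E C γ : ℝ),
    RelaxingData g h ν v₀ v E C γ ∧
    ∀ f : 𝕋² → ℝ, IsSmooth f → HasZeroMean f → UniformlyRelaxes ν v C γ f

/-- The VORTICITY LOCK (chain: `Ideator4.NoCoRelaxation`, r2-N1 `NoUniversalRelaxer`): no steadily
forced planar Leray–Hopf family relaxes every profile, because it never relaxes its own vorticity
source `curl g` (ω_j is the `curl g`-sourced Pr = 1 scalar; `(U_{curl g})` + `RelaxationBoundsInventory`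
cap the enstrophy; Seis then forbids `(U_h)`). Stated here as the hypothesis of the next theorem;
its proof needs `curl g` smooth mean-zero and the `g = 0` corner (decaying family, no relaxation). -/
def VorticityLock : Prop := ¬ UniversalRelaxingFamily

/-- **The `stub_boost` death, foreseen (kernel-checked logic):** under the lock, the transfer stub
`RelaxingFamily → UniversalRelaxingFamily` of the source-genericity split D2 holds iff crux r3 is FALSE.
So D2 is not a decomposition of `FloorUpgrade` but a costume of `¬ RelaxingFamily`. [folklore] -/
theorem universalTransfer_iff_not_relaxingFamily (hLock : VorticityLock) :
    (RelaxingFamily → UniversalRelaxingFamily) ↔ ¬ RelaxingFamily :=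
  ⟨fun hT hR => hLock (hT hR), fun hn hR => (hn hR).elim⟩

/-! ## 3. Strengthen S4: the budget-augmented kinematic floor and its budget-respecting enemy -/

/-- A KINEMATIC relaxer of `h` (the clauses of `RelaxingFamily` with Leray–Hopf removed; copy of
`Ideator4.IsKinematicRelaxer`, restated through `UniformlyRelaxes`). -/
def IsKinematicRelaxer (h : 𝕋² → ℝ) (ν : ℕ → ℝ) (u : ℕ → ℝ → 𝕋² → E²) : Prop :=
  IsSmooth h ∧ HasZeroMean h ∧ h ≠ 0 ∧
  (∀ j, 0 < ν j) ∧ Tendsto ν atTop (𝓝 0) ∧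
  (∀ j, IsSmoothSpaceTimeOn (Ici (0 : ℝ)) (u j)) ∧
  (∀ j t, 0 ≤ t → IsDivFree (u j t)) ∧
  (∀ j : ℕ, ∀ T : ℝ, 0 < T → MemLp (stLift (u j)) ⊤ (volume.restrict (Ioo (0 : ℝ) T ×ˢ univ))) ∧
  (∃ E : ℝ, ∀ j, ∀ᶠ T in atTop, timeMean (fun t => ∫ x, ‖u j t x‖ ^ 2) T ≤ E) ∧
  ∃ C γ : ℝ, 0 ≤ C ∧ 0 < γ ∧ UniformlyRelaxes ν u C γ h

/-- The three NS BUDGETS every bounded-energy steadily forced planar Leray–Hopf family obeys, typed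
junk-free (eventual bounds on lower Lebesgue space–time integrals, no `toReal`/`limsup` junk):
Alexakis–Doering `⟨‖∇u_j‖²⟩ ≲ ν_j^{-1/2}` (hence `ν_j⟨‖∇u_j‖²⟩ → 0`) and the enstrophy-dissipation
budget `ν_j⟨‖Δu_j‖²⟩ = ν_j⟨‖∇ω_j‖²⟩ ≤ B` (for NS families `B = ‖Δg‖√E`). The chain's kinematic
counterexamples (α = 1/2, k = m, ν = 3/(4π²m²)) violate all of them: `νZ = 3/8`, `Z = 3/(8ν)`, `η ≈ (3/2)π²m²`. -/
def IsBudgeted (ν : ℕ → ℝ) (u : ℕ → ℝ → 𝕋² → E²) (B : ℝ) : Prop :=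
  (∀ j, ∀ᶠ T in atTop,
    ∫⁻ t in Ioo (0 : ℝ) T, eGradNormSq (u j t) ≤ ENNReal.ofReal (B * T / Real.sqrt (ν j))) ∧
  (∀ j, ∀ᶠ T in atTop,
    ∫⁻ t in Ioo (0 : ℝ) T, eLaplacianNormSq (u j t) ≤ ENNReal.ofReal (B * T / ν j))

/-- **S4, the budget-augmented kinematic floor** (signature): every kinematic relaxer that ALSO obeys
the NS budgets floors its source. If TRUE it would be an honest NS-free line for `FloorUpgrade`
(budgets are theorems for LH families); the census predicts it FALSE via `BudgetedCoboundaryRelaxer`. -/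
def BudgetedKinematicFloor : Prop :=
  ∀ (h : 𝕋² → ℝ) (ν : ℕ → ℝ) (u : ℕ → ℝ → 𝕋² → E²) (B : ℝ),
    IsKinematicRelaxer h ν u → IsBudgeted ν u B → HasFloor ν u h

/-- **The budget-respecting coboundary relaxer** (Disproof-side target sharpened by this census; toy
`brcr.py` series B): a kinematic relaxer obeying the NS budgets for which the source is the EXACT material
derivative of a steady smooth transfer field. Candidate: `u_j = (a(y), R_j(t,x))` with fine vertical
shear of gradient `S_j ≍ ν_j^{-1/4}` at O(1) amplitude (`η ≍ 1`, `Z ≍ ν^{-1/2}`), `h = a(y)cos 2πx`. -/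
def BudgetedCoboundaryRelaxer : Prop :=
  ∃ (h χ : 𝕋² → ℝ) (ν : ℕ → ℝ) (u : ℕ → ℝ → 𝕋² → E²) (B : ℝ),
    IsKinematicRelaxer h ν u ∧ IsBudgeted ν u B ∧ IsSmooth χ ∧
    ∀ (j : ℕ) (t : ℝ), 0 ≤ t → ∀ x, ⟪u j t x, gradient χ x⟫_ℝ = h x

/-- `CoboundaryKill` (copy of `Ideator4.CoboundaryKill`; TRUE on paper, TRIAGE-r2-1/2): an exact steady
smooth transfer field kills the absorbed power at rate `6ν‖∇χ‖²`, whatever the mixing. -/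
def CoboundaryKill : Prop :=
  ∀ (κ : ℝ) (u : ℝ → 𝕋² → E²) (χ h : 𝕋² → ℝ) (θ : ℝ → 𝕋² → ℝ), 0 < κ →
    IsSmooth χ → IsSmooth h →
    (∀ T : ℝ, 0 < T → MemLp (stLift u) ⊤ (volume.restrict (Ioo (0 : ℝ) T ×ˢ univ))) →
    (∀ t : ℝ, 0 ≤ t → ∀ x, ⟪u t x, gradient χ x⟫_ℝ = h x) →
    IsWeakScalarTransportForced κ u (fun _ => h) 0 θ →
      longTimeAvgSup (fun t => κ * (eScalarGradNormSq (θ t)).toReal) ≤ 6 * κ * scalarGradNormSq χ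

/-- **Wiring (kernel-checked):** a budget-respecting coboundary relaxer refutes S4 exactly as the
chain's relaxer refutes `K1_kin` — the budgets do not touch the coboundary identity. [folklore] -/
theorem budgetedKinematicFloor_false_of (hK : CoboundaryKill) (hQ : BudgetedCoboundaryRelaxer) :
    ¬ BudgetedKinematicFloor := by
  intro hF
  obtain ⟨h, χ, ν, u, B, hrel, hbud, hχ, hcob⟩ := hQ
  obtain ⟨ε, hε, hfloor⟩ := hF h ν u B hrel hbud
  obtain ⟨hh, _, _, hνpos, hνlim, _, _, hbd, _⟩ := hrel
  set c : ℝ := scalarGradNormSq χ with hc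
  have hc0 : 0 ≤ c := integral_nonneg fun _ => sq_nonneg _
  have hev : ∀ᶠ j in atTop, ν j < ε / (6 * c + 1) := by
    have hpos : 0 < ε / (6 * c + 1) := div_pos hε (by positivity)
    exact (tendsto_order.1 hνlim).2 _ hpos
  obtain ⟨j, hj⟩ := hev.exists
  obtain ⟨θ, hθ, hεle⟩ := hfloor j
  have hkill := hK (ν j) (u j) χ h θ (hνpos j) hχ hh (hbd j) (hcob j) hθ
  have h6 : 6 * ν j * c < ε := by
    have h1 : ν j * (6 * c + 1) < ε := by
      have := hj
      rwa [lt_div_iff₀ (by positivity)] at this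
    nlinarith [hνpos j]
  linarith

/-! ## 4. Transfer T3(b) / Decomposition D3: the polarisation (helicity) floor — a TOOL, not a line -/

/-- The planar curl `∂₁g₂ − ∂₂g₁` (vorticity source `curl g`; copy of `Ideator4.planarCurl`). -/
def planarCurl (g : 𝕋² → E²) (x : 𝕋²) : ℝ :=
  (partialDeriv 0 g x) 1 - (partialDeriv 1 g x) 0

/-- **Polarisation floor (Sub₁ of D3; provable on paper: 2-D vorticity equation + enstrophy balance +
Cauchy–Schwarz on `ν⟨⟨∇θ·∇ω⟩⟩`).** For ONE steadily forced planar Leray–Hopf solution with smooth datum,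
essentially bounded on bounded slabs, eventual Cesàro energy `≤ E`, and the `h`-sourced scalar `θ` from
zero datum: with `A_T := T⁻¹∫₀ᵀ∫ v·∇⊥h` (mean-flow circulation against `∇⊥h = (−∂₂h, ∂₁h)`) and
`B_T := T⁻¹∫₀ᵀ∫ (curl g) θ` (response measured on the vorticity source),
`(limsup_T |B_T − A_T|)² ≤ 4 ‖Δg‖₂ √E · ⟨ν‖∇θ‖²⟩` — the floor follows from NON-DEGENERACY of a
first-order statistic. REJECTED as a decomposition because no-floor forces `B_T − A_T → 0`
(`Q² ≤ Pη`), so the residual Sub₂ is K1′ reworded; kept as a tool / design rule for r2. -/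
def PolarisationFloor : Prop :=
  ∀ (g : 𝕋² → E²) (h : 𝕋² → ℝ) (ν E : ℝ) (v₀ : 𝕋² → E²) (v : ℝ → 𝕋² → E²) (θ : ℝ → 𝕋² → ℝ),
    IsSmooth g → IsDivFree g → HasZeroMean g → IsSmooth h → HasZeroMean h → 0 < ν →
    IsSmooth v₀ → IsGlobalLerayHopf ν (fun _ => g) v₀ v →
    (∀ T : ℝ, 0 < T → MemLp (stLift v) ⊤ (volume.restrict (Ioo (0 : ℝ) T ×ˢ univ))) →
    (∀ᶠ T in atTop, timeMean (fun t => ∫ x, ‖v t x‖ ^ 2) T ≤ E) →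
    IsWeakScalarTransportForced ν v (fun _ => h) 0 θ →
      (limsup (fun T => |timeMean (fun t =>
          (∫ x, planarCurl g x * θ t x) -
          (∫ x, (-(v t x 0) * (gradient h x 1) + (v t x 1) * (gradient h x 0)))) T|) atTop) ^ 2 ≤
        4 * Real.sqrt (∫ x, ‖laplacian g x‖ ^ 2) * Real.sqrt E *
          longTimeAvgSup (fun t => ν * (eScalarGradNormSq (θ t)).toReal)

end Summit.AnomalousDissipation.AnomalousDissipation.Cruxes.FloorUpgrade.Strategist1

end
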